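import Literature.MathematicalPhysics.QuantumFieldTheory.Balaban1983to89.Step

/-!
# `Balaban1983to89.B14.LargeFieldFactorD4` — [Balaban1988Convergent] §0 p. 244 [PDF 2], lines 18–35 (the passage that
# MOTIVATES the operation 𝐑; the same sentences are printed verbatim in [Balaban1989LargeFieldI] §0 p. 175 after (0.1)):
# the one-plaquette large-field factor, its printed display, the `d < 4` clause («an arbitrarily large power of ε») and the
# `d = 4` clause («does not give any positive power of ε … it controls a large number of steps, but this number is a small
# fraction of the total number of steps») — ALL AS ELEMENTARY REAL ANALYSIS, PROVED (theorems only; nothing of Bałaban asserted)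

statement-level skeleton of published theorems with citation tags; proofs where landed; nothing here is a claim about
the Yang–Mills mass gap.

CITATION HEADER (lean-in-tree rule 2026-08-18).  T. Bałaban, *Convergent renormalization expansions for lattice gauge
theories*, Commun. Math. Phys. **119**, 243–285 (1988), doi:10.1007/bf01217741, bib `Balaban1988Convergent` (cell paper
B14 = [III]; journal page = PDF page + 242; held text `paper:balaban1988-cmp119-convergent-renormalization`, page render
`run/shared/lean/pub/pub-balaban/b2b-balaban-ref1/pages/1988-cmp119-convergent-renormalization/…-p002-x2.png` RE-READ for
the display below); T. Bałaban, *Large field renormalization. I. The basic step of the 𝐑 operation*, Commun. Math. Phys.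
**122**, 175–202 (1989), bib `Balaban1989LargeFieldI` ([IV]; p. 175 = PDF 1, (0.1)).  Mega-formalization `lit-balaban`
(HOME `run/shared/lean/pub/lit-balaban/`), R141 (B) typer seat `lit-balaban-type-B14` (gen 0; pub-ymgap DAG node N11 =
[III] Thm 1 p. 262, Thm 2 p. 263, Cor 3 p. 264, 𝐑 assumed p. 244).  SKELETON rows touched: none of record for [III]
(p. 244 carries rows B14.Eq0.2 (0.2) and B14.Def@244R (the assumption sentence, `…B14.RAssumedP244`) only); row
B15.Eq0.1 ((0.1) p. 175, owner r12) carries the dichotomy as «(prose)» — this module is a FREE TARGET with zero head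
weight.  Imports `…Balaban1983to89.Step` (for `Setup`'s profile `p0Profile` and Step Part D4's (0.1) lemmas, cited BY
NAME); modifies nothing; NO `def`, NO new `Prop`, NO named fact (D-0026: theorems only).

THE PRINTED TEXT (verbatim, p. 244 [PDF 2]).  «Consider a large plaquette variable in the first step. The restrictions on
these variables are the same as in [16], so we have |U(∂p) − 1| ≧ g₀p₀(g₀) for a plaquette p ∈ T₁, where p₀(g₀) =
A₀(log g₀⁻²)^{p₀} with a positive integer p₀. The term in the Wilson action, corresponding to the plaquette p, gives the
estiomate [sic]
    exp[−(1/g₀²)[1 − Re tr U(∂p)]] ≦ exp(−½ p₀²(g₀²)) ≦ g₀^{A₀(log g₀⁻²)^{p₀−1}} .        (display, unnumbered)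
For d < 4 we have g₀ = gε^{1/2(4−d)}, and the bound above can be estimated by an arbitrarily large power of ε. This is
enough to control expressions arising in the large field regions surrounding the plaquette p for all steps of the
procedure, i.e., until we reach the unit lattice. For d = 4 the bare coupling constant behaves asymptotically as
(a + b log ε⁻¹)^{−1/2}, for ε → 0, with some positive constants a, b, hence the bound does not give any positive power
of ε. It is still small for ε small, and it controls a large number of steps, but this number is a small fraction of
the total number of steps. Thus, for some large field regions there is a difficulty in continuing the procedure of
[16], the small factor arising from large fields in this region does not control further steps. In such situations we
have to change the procedure in order to improve the small factor, i.e., we have to be able to renormalize the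
expression corresponding to the large field region.»  (Next sentence, p. 244 ll. 36–38 = `…B14.RAssumedP244`: «The
operation 𝐑 serves this purpose. We will not describe it here, we will only assume that it has some properties
incorporated in the inductive description of the effective actions.»)  READING NOTES. (r1) The middle member is printed
«p₀²(g₀²)» — read `p₀(g₀)²` ([16] = [Balaban1985UV3] (11) p. 258 prints «exp(−½p²(g₀))», cell `…B10.smallFactor_le_pow`;
[IV] (0.1) prints «exp(−p₀(g₀))»); the inner square is taken as a print slip.  (r2) The last member's exponent is read
`A₀(log g₀⁻²)^{p₀−1}` as in [IV] (0.1) («= g₀^{A₀(log g₀⁻²)^{p₀−1}}», cell DIVERGENCE D-f2.10 / `…Step.exp_neg_p0Profile_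
eq_rpow`); with this reading the second «≦» holds exactly when `p₀(g₀) ≥ 1` (proved below), i.e. for `g₀` small.
(r3) `p₀(g₀)` = `Setup`'s `p0Profile A₀ p₀ g₀ = A₀ (log (g₀²)⁻¹)^{p₀}` ((1.4) p. 246, (2.4) p. 255).  (r4) «the total
number of steps» = `K` with `ε = L^{−K}` ((0.2) p. 244 «we finish the inductive procedure when we reach the unit
lattice»), i.e. `K = log ε⁻¹ / log L` (`steps_eq_log_div_log`).  (r5) «it controls a number n of steps» is read, as in
[16] Sect. D and [II′] = [Balaban1989LargeFieldII] (1.79)–(1.80) p. 383 (cell `…Step.Budget`), as: a factor `e^{−P}` pays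
for `n` steps of cost `e^{c}` each (`c > 0` a constant) iff `n ≤ P/c`; so the number of controlled steps is `P/c` with
`P = ½p₀(g₀)²` (middle member) or `P = ½p₀(g₀)` (last member) — both of the form `p0Profile A q g₀` (`(A, q) =
(½A₀², 2p₀)` resp. `(½A₀, p₀)`), which is why §3 is stated for a general prefactor `A` and exponent `q`.

WHAT THIS FILE PROVES (all `theorem`s; every input a binder).
§1 THE DISPLAY.  `half_sq_threshold` (the exponent step `(1/g₀²)·½t² ≥ ½p₀(g₀)²` for `t ≥ g₀p₀(g₀)`),
`exp_action_le_exp_neg_half_sq` (first «≦»: from the two printed inputs — the restriction `|U(∂p) − 1| ≥ g₀p₀(g₀)` and the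
trace inequality `1 − Re tr U ≥ ½|U − 1|²` of [16] (11), cell `…B10Eq11Trace` — as real hypotheses on the numbers
`t = |U(∂p) − 1|`, `w = 1 − Re tr U(∂p)`), `rpow_eq_exp_neg_half_p0Profile` (the last member IS `exp(−½p₀(g₀))`),
`exp_neg_half_p0Profile_sq_le_rpow` (second «≦», under `p₀(g₀) ≥ 1`).
§2 `d < 4`.  `rpow_bound_le_eps_pow`: with `g₀ = g·ε^{s}`, `s = (4−d)/2 > 0`, `0 < g ≤ 1`, `0 < ε ≤ 1`, the last member
`g₀^{x}` is `≤ ε^{N}` for EVERY `N ≥ 0` as soon as `x ≥ N/s` («an arbitrarily large power of ε»; the exponent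
`x = A₀(log g₀⁻²)^{p₀−1} → ∞` as `g₀ → 0`); `largeFieldFactor_le_eps_pow_of_d_lt_four` (the display's middle member
`≤ ε^N` under the same smallness).
§3 `d = 4`.  For the printed asymptotic form of the bare coupling, `g₀(ε) = (a + b log ε⁻¹)^{−1/2}` — written
`(Real.sqrt (a + b * Real.log ε⁻¹))⁻¹` — with `b > 0` (print: «positive constants a, b»; only `b > 0` is used, `a ∈ ℝ`),
and `P(ε) = p0Profile A q (g₀(ε))` (`= A·(log(a + b log ε⁻¹))^{q}` eventually, `p0Profile_bareD4`), along `ε → 0⁺`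
(`𝓝[>] 0`): `tendsto_p0Profile_bareD4_atTop` (`P(ε) → ∞` for `A > 0`, `q ≥ 1`: «it controls a large number of steps»),
`tendsto_largeFieldFactor_bareD4_zero` (`e^{−P(ε)} → 0`: «It is still small for ε small»),
`isLittleO_p0Profile_bareD4_log` (`P(ε) = o(log ε⁻¹)`) and `tendsto_stepsRatio_bareD4_zero` (`(P(ε)/c)/(log ε⁻¹/log L)
→ 0`: «this number is a small fraction of the total number of steps»), `eventually_pow_lt_largeFieldFactor_bareD4`
(for every `N > 0` and every `C`: eventually `C·ε^{N} < e^{−P(ε)}`), `not_eventually_largeFieldFactor_le_pow` and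
`isLittleO_pow_largeFieldFactor_bareD4` (`ε^{N} = o(e^{−P(ε)})`: «the bound does not give any positive power of ε»).
The `t = log ε⁻¹ → ∞` versions (private helpers `tendsto_logpow_affine_atTop`, `isLittleO_logpow_affine_atTop`,
`eventually_logpow_lt_linear`) carry the analysis; Mathlib's `Real.isLittleO_pow_log_id_atTop` is the engine.

HONEST SCOPE.  (1) Nothing of Bałaban's bare coupling `g₀(ε, g)` is asserted: its logarithmic running is [I] =
[Balaban1987RG1] Thm 2 ((0.31) p. 259; unproved in the series, cell `…FlowStep` §5 / `…T4BareLambdaRate`), and the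
printed asymptotic form `(a + b log ε⁻¹)^{−1/2}` enters §3 as THE DEFINITION of the function studied — the theorems are
statements about that explicit function.  (2) §1 takes the two field-level inputs of the first «≦» as real hypotheses;
their field-level forms are cell modules `…B10Eq11Trace` ([16] (11)) and `…B15Chi175LargeFieldFactor` ([IV] p. 193), not
restated.  (3) The `d < 4` half at the level of `exp(−p₀(g))` / `exp(−½p(g)²)` versus powers of `g` is already in the tree
(`…Step.exp_neg_p0Profile_le_pow`, `…B10.smallFactor_le_pow`); §2 only adds the passage from powers of `g₀ = gε^{s}` to
powers of `ε`.  (4) One finite T⁴ programme at fixed `ε`, Bałaban as printed; count-neutral; nothing continuum / ℝ⁴ / OS /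
mass gap / Clay.

## References
* [Balaban1988Convergent] T. Bałaban, Commun. Math. Phys. 119 (1988) 243–285: §0 p. 244 (display and ll. 18–38), (0.2) p. 244.
* [Balaban1989LargeFieldI] T. Bałaban, Commun. Math. Phys. 122 (1989) 175–202: (0.1) p. 175 and the same paragraph.
* [Balaban1985UV3] T. Bałaban, Commun. Math. Phys. 102 (1985) 255–275: (11) p. 258 ([16] of [I]'s list).
-/

noncomputable section

open _root_.Filter _root_.Asymptotics
open scoped _root_.Topology

namespace Literature.MathematicalPhysics.QuantumFieldTheory.Balaban1983to89.B14.LargeFieldFactorD4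

open Literature.MathematicalPhysics.QuantumFieldTheory.Balaban1983to89

/-! ## §1. The display of p. 244: `exp[−g₀⁻²(1 − Re tr U(∂p))] ≤ exp(−½p₀(g₀)²) ≤ g₀^{A₀(log g₀⁻²)^{p₀−1}}` -/

/-- The exponent step behind the first «≦» of the p. 244 display: if the plaquette variable is large,
`t = |U(∂p) − 1| ≥ g₀·p₀(g₀)` (p. 244: «we have |U(∂p) − 1| ≧ g₀p₀(g₀) for a plaquette p ∈ T₁»), then
`(1/g₀²)·(½t²) ≥ ½p₀(g₀)²`.  Elementary (`p` stands for the number `p₀(g₀) ≥ 0`). [cite: Balaban1988Convergent, p.244] -/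
theorem half_sq_threshold {g₀ p t : ℝ} (hg : 0 < g₀) (hp : 0 ≤ p) (ht : g₀ * p ≤ t) :
    (1 / 2) * p ^ 2 ≤ g₀⁻¹ ^ 2 * ((1 / 2) * t ^ 2) := by
  have h1 : (g₀ * p) ^ 2 ≤ t ^ 2 := pow_le_pow_left₀ (by positivity) ht 2
  have h2 : (1 / 2) * p ^ 2 = g₀⁻¹ ^ 2 * ((1 / 2) * (g₀ * p) ^ 2) := by
    field_simp
  rw [h2]
  exact mul_le_mul_of_nonneg_left (mul_le_mul_of_nonneg_left h1 (by norm_num)) (by positivity)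

/-- **First «≦» of the p. 244 display** [PDF 2], verbatim: «The term in the Wilson action, corresponding to the plaquette
p, gives the estiomate exp[−(1/g₀²)[1 − Re tr U(∂p)]] ≦ exp(−½ p₀²(g₀²)) [sic: `p₀(g₀)²`, reading note (r1)]».  Typed on
the real numbers entering it: `w = 1 − Re tr U(∂p)` and `t = |U(∂p) − 1|` with the trace inequality `½t² ≤ w` ([16] (11)
p. 258, cell `…B10Eq11Trace`; normalised trace / Hilbert–Schmidt conventions, cell DIVERGENCE D-b10.1) and the
large-plaquette restriction `g₀·p₀(g₀) ≤ t`; conclusion `exp(−g₀⁻²w) ≤ exp(−½p₀(g₀)²)` with `p₀(g₀) = p0Profile A₀ p₀ g₀`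
(`A₀ ≥ 0`, `0 < g₀ ≤ 1` make `p₀(g₀) ≥ 0`).  Elementary. [cite: Balaban1988Convergent, p.244] -/
theorem exp_action_le_exp_neg_half_sq {A₀ g₀ w t : ℝ} {p₀ : ℕ} (hA : 0 ≤ A₀) (hg : 0 < g₀) (hg1 : g₀ ≤ 1)
    (htr : (1 / 2) * t ^ 2 ≤ w) (ht : g₀ * p0Profile A₀ p₀ g₀ ≤ t) :
    Real.exp (-(g₀⁻¹ ^ 2 * w)) ≤ Real.exp (-((1 / 2) * p0Profile A₀ p₀ g₀ ^ 2)) := by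
  have hP : 0 ≤ p0Profile A₀ p₀ g₀ := by
    unfold p0Profile
    have hl : 0 ≤ Real.log (g₀ ^ 2)⁻¹ := by
      apply Real.log_nonneg
      have h2 : g₀ ^ 2 ≤ 1 := by nlinarith
      exact one_le_inv_iff₀.mpr ⟨by positivity, h2⟩
    positivity
  have h1 := half_sq_threshold hg hP ht
  have h2 : g₀⁻¹ ^ 2 * ((1 / 2) * t ^ 2) ≤ g₀⁻¹ ^ 2 * w := mul_le_mul_of_nonneg_left htr (by positivity)
  exact Real.exp_le_exp.mpr (by linarith)

/-- The last member of the p. 244 display IS `exp(−½p₀(g₀))`: for `0 < g₀` and `p₀ ≥ 1`,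
`g₀^{A₀(log g₀⁻²)^{p₀−1}} = exp(−½·p0Profile A₀ p₀ g₀)` (since `g₀^{x} = exp(x log g₀)` and `log g₀ = −½ log g₀⁻²`;
reading note (r2); companion of `…Step.exp_neg_p0Profile_eq_rpow`, which has the exponent doubled).  Elementary. [cite: Balaban1988Convergent, p.244] -/
theorem rpow_eq_exp_neg_half_p0Profile {A₀ g₀ : ℝ} {p₀ : ℕ} (hp : 1 ≤ p₀) (hg : 0 < g₀) :
    g₀ ^ (A₀ * Real.log (g₀ ^ 2)⁻¹ ^ (p₀ - 1)) = Real.exp (-(1 / 2) * p0Profile A₀ p₀ g₀) := by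
  obtain ⟨q, rfl⟩ : ∃ q, p₀ = q + 1 := ⟨p₀ - 1, by omega⟩
  rw [Real.rpow_def_of_pos hg, p0Profile, Nat.add_sub_cancel, Real.log_inv, Real.log_pow, pow_succ]
  congr 1
  push_cast
  ring

/-- **Second «≦» of the p. 244 display** [PDF 2], verbatim: «… ≦ exp(−½ p₀²(g₀²)) ≦ g₀^{A₀(log g₀⁻²)^{p₀−1}}» (reading
notes (r1), (r2)): `exp(−½p₀(g₀)²) ≤ g₀^{A₀(log g₀⁻²)^{p₀−1}}` for `0 < g₀`, `p₀ ≥ 1` and `p₀(g₀) ≥ 1` — the right-hand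
side being `exp(−½p₀(g₀))` (`rpow_eq_exp_neg_half_p0Profile`), this is `p₀(g₀)² ≥ p₀(g₀)`, i.e. exactly the regime
`p₀(g₀) ≥ 1` (`g₀` small; for `0 < p₀(g₀) < 1` the printed inequality fails, which is immaterial in print's use). [cite: Balaban1988Convergent, p.244] -/
theorem exp_neg_half_p0Profile_sq_le_rpow {A₀ g₀ : ℝ} {p₀ : ℕ} (hp : 1 ≤ p₀) (hg : 0 < g₀)
    (hP : 1 ≤ p0Profile A₀ p₀ g₀) :
    Real.exp (-((1 / 2) * p0Profile A₀ p₀ g₀ ^ 2)) ≤ g₀ ^ (A₀ * Real.log (g₀ ^ 2)⁻¹ ^ (p₀ - 1)) := by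
  rw [rpow_eq_exp_neg_half_p0Profile hp hg, Real.exp_le_exp]
  nlinarith

/-! ## §2. `d < 4`: «g₀ = gε^{1/2(4−d)}, and the bound above can be estimated by an arbitrarily large power of ε» -/

/-- **The `d < 4` clause of p. 244** [PDF 2], verbatim: «For d < 4 we have g₀ = gε^{1/2(4−d)}, and the bound above can be
estimated by an arbitrarily large power of ε.»  Typed: with `g₀ = g·ε^{s}` (`s = (4−d)/2 > 0`; `0 < g ≤ 1`, `0 < ε ≤ 1`)
the last member `g₀^{x}` of the display is `≤ ε^{N}` for every `N ≥ 0` as soon as the exponent satisfies `x ≥ N/s` —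
and `x = A₀(log g₀⁻²)^{p₀−1}` grows without bound as `g₀ → 0` (for `p₀ ≥ 2`), so every power of `ε` is reached for `ε`
small.  Elementary (`g₀^{x} ≤ g₀^{N/s} = g^{N/s}ε^{N} ≤ ε^{N}`). [cite: Balaban1988Convergent, p.244] -/
theorem rpow_bound_le_eps_pow {g ε s x N : ℝ} (hg : 0 < g) (hg1 : g ≤ 1) (hε : 0 < ε) (hε1 : ε ≤ 1) (hs : 0 < s)
    (hN : 0 ≤ N) (hx : N / s ≤ x) : (g * ε ^ s) ^ x ≤ ε ^ N := by
  have hεs : 0 ≤ ε ^ s := Real.rpow_nonneg hε.le s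
  have hg₀ : 0 < g * ε ^ s := mul_pos hg (Real.rpow_pos_of_pos hε s)
  have hg₀1 : g * ε ^ s ≤ 1 := by
    have h1 : ε ^ s ≤ 1 := Real.rpow_le_one hε.le hε1 hs.le
    calc g * ε ^ s ≤ 1 * 1 := mul_le_mul hg1 h1 hεs zero_le_one
      _ = 1 := one_mul 1
  have hs' : s ≠ 0 := hs.ne'
  calc (g * ε ^ s) ^ x ≤ (g * ε ^ s) ^ (N / s) := Real.rpow_le_rpow_of_exponent_ge hg₀ hg₀1 hx
    _ = g ^ (N / s) * (ε ^ s) ^ (N / s) := Real.mul_rpow hg.le hεs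
    _ ≤ 1 * ε ^ N := by
        have h1 : g ^ (N / s) ≤ 1 := Real.rpow_le_one hg.le hg1 (div_nonneg hN hs.le)
        have h2 : (ε ^ s) ^ (N / s) = ε ^ N := by
          rw [← Real.rpow_mul hε.le]
          congr 1
          field_simp
        rw [h2]
        exact mul_le_mul_of_nonneg_right h1 (Real.rpow_nonneg hε.le N)
    _ = ε ^ N := one_mul _

/-- The `d < 4` clause for the display's MIDDLE member: under the hypotheses of `exp_neg_half_p0Profile_sq_le_rpow` at
`g₀ = g·ε^{s}` and the smallness `A₀(log g₀⁻²)^{p₀−1} ≥ N/s`, `exp(−½p₀(g₀)²) ≤ ε^{N}` — «an arbitrarily large power of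
ε». [cite: Balaban1988Convergent, p.244] -/
theorem largeFieldFactor_le_eps_pow_of_d_lt_four {A₀ g ε s N : ℝ} {p₀ : ℕ} (hp : 1 ≤ p₀) (hg : 0 < g) (hg1 : g ≤ 1)
    (hε : 0 < ε) (hε1 : ε ≤ 1) (hs : 0 < s) (hN : 0 ≤ N) (hP : 1 ≤ p0Profile A₀ p₀ (g * ε ^ s))
    (hx : N / s ≤ A₀ * Real.log ((g * ε ^ s) ^ 2)⁻¹ ^ (p₀ - 1)) :
    Real.exp (-((1 / 2) * p0Profile A₀ p₀ (g * ε ^ s) ^ 2)) ≤ ε ^ N :=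
  (exp_neg_half_p0Profile_sq_le_rpow hp (mul_pos hg (Real.rpow_pos_of_pos hε s)) hP).trans
    (rpow_bound_le_eps_pow hg hg1 hε hε1 hs hN hx)

/-! ## §3. `d = 4`: the bare coupling `g₀(ε) = (a + b log ε⁻¹)^{−1/2}` — no positive power of `ε`, and `o(log ε⁻¹)` steps

Throughout, `g₀(ε)` is written `(Real.sqrt (a + b * Real.log ε⁻¹))⁻¹` and the profile is `P(ε) = p0Profile A q (g₀(ε))`
(reading note (r5): `(A, q) = (½A₀, p₀)` for the last member of the display, `(½A₀², 2p₀)` for the middle member).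
The variable `t = log ε⁻¹` carries the analysis (`t → ∞` as `ε → 0⁺`). -/

/-- `t ↦ a + b·t → ∞` for `b > 0`. [folklore] -/
private theorem tendsto_affine_atTop (a : ℝ) {b : ℝ} (hb : 0 < b) : Tendsto (fun t : ℝ => a + b * t) atTop atTop :=
  tendsto_atTop_add_const_left atTop a (Tendsto.const_mul_atTop hb tendsto_id)

/-- `A·(log(a + b·t))^{q} → ∞` as `t → ∞`, for `A > 0`, `b > 0`, `q ≥ 1`. [folklore] -/
private theorem tendsto_logpow_affine_atTop (a : ℝ) {b A : ℝ} (hb : 0 < b) (hA : 0 < A) {q : ℕ} (hq : 1 ≤ q) :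
    Tendsto (fun t : ℝ => A * Real.log (a + b * t) ^ q) atTop atTop := by
  have h1 : Tendsto (fun t : ℝ => Real.log (a + b * t)) atTop atTop :=
    Real.tendsto_log_atTop.comp (tendsto_affine_atTop a hb)
  have h2 : Tendsto (fun t : ℝ => Real.log (a + b * t) ^ q) atTop atTop :=
    (tendsto_pow_atTop (by omega : q ≠ 0)).comp h1
  exact h2.const_mul_atTop hA

/-- `A·(log(a + b·t))^{q} = o(t)` as `t → ∞` (`b > 0`): powers of a logarithm are `o` of a linear function
(Mathlib `Real.isLittleO_pow_log_id_atTop`, composed with `t ↦ a + b·t`). [folklore] -/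
private theorem isLittleO_logpow_affine_atTop (a A : ℝ) {b : ℝ} (hb : 0 < b) (q : ℕ) :
    (fun t : ℝ => A * Real.log (a + b * t) ^ q) =o[atTop] (fun t : ℝ => t) := by
  have h1 : (fun s : ℝ => Real.log s ^ q) =o[atTop] id := Real.isLittleO_pow_log_id_atTop
  have h2 : (fun t : ℝ => Real.log (a + b * t) ^ q) =o[atTop] (fun t : ℝ => a + b * t) :=
    h1.comp_tendsto (tendsto_affine_atTop a hb)
  have h3 : (fun t : ℝ => a + b * t) =O[atTop] (fun t : ℝ => t) := by
    have ha : (fun _ : ℝ => a) =O[atTop] (fun t : ℝ => t) := (isLittleO_const_id_atTop a).isBigO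
    have hbt : (fun t : ℝ => b * t) =O[atTop] (fun t : ℝ => t) := isBigO_const_mul_self b (fun t : ℝ => t) atTop
    exact ha.add hbt
  exact (h2.trans_isBigO h3).const_mul_left A

/-- Eventually (as `t → ∞`) `A·(log(a + b·t))^{q} < N·t − C₀`, for every `N > 0` and every constant `C₀` (`b > 0`).
[folklore] -/
private theorem eventually_logpow_lt_linear (a A : ℝ) {b : ℝ} (hb : 0 < b) (q : ℕ) {N : ℝ} (hN : 0 < N) (C₀ : ℝ) :
    ∀ᶠ t : ℝ in atTop, A * Real.log (a + b * t) ^ q < N * t - C₀ := by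
  have h2 : ∀ᶠ t : ℝ in atTop, ‖A * Real.log (a + b * t) ^ q‖ ≤ N / 2 * ‖t‖ :=
    (isLittleO_logpow_affine_atTop a A hb q).bound (by positivity)
  have h3 : ∀ᶠ t : ℝ in atTop, C₀ < N / 2 * t :=
    (Tendsto.const_mul_atTop (by positivity : 0 < N / 2) tendsto_id).eventually_gt_atTop C₀
  filter_upwards [h2, h3, eventually_ge_atTop (0 : ℝ)] with t ht hC ht0
  have h4 : A * Real.log (a + b * t) ^ q ≤ N / 2 * t := by
    calc A * Real.log (a + b * t) ^ q ≤ ‖A * Real.log (a + b * t) ^ q‖ := Real.le_norm_self _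
      _ ≤ N / 2 * ‖t‖ := ht
      _ = N / 2 * t := by rw [Real.norm_of_nonneg ht0]
  linarith

/-- `log ε⁻¹ → ∞` as `ε → 0⁺`. [folklore] -/
private theorem tendsto_log_inv_nhdsGT_zero : Tendsto (fun ε : ℝ => Real.log ε⁻¹) (𝓝[>] (0 : ℝ)) atTop :=
  Real.tendsto_log_atTop.comp tendsto_inv_nhdsGT_zero

/-- «the total number of steps» (reading note (r4)): with `ε = L^{−K}` ((0.2) p. 244: the procedure runs from the
`ε`-lattice to the unit lattice in `K` steps of scale factor `L > 1`), `log ε⁻¹ / log L = K`. [cite: Balaban1988Convergent, (0.2) p.244] -/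
theorem steps_eq_log_div_log {L : ℝ} (hL : 1 < L) (K : ℕ) :
    Real.log ((L ^ K)⁻¹)⁻¹ / Real.log L = K := by
  have hlogL : Real.log L ≠ 0 := (Real.log_pos hL).ne'
  rw [inv_inv, Real.log_pow, mul_div_assoc, div_self hlogL, mul_one]

/-- For `a + b log ε⁻¹ > 0` the model coupling `g₀(ε) = (a + b log ε⁻¹)^{−1/2}` of p. 244 («the bare coupling constant
behaves asymptotically as (a + b log ε⁻¹)^{−1/2}») satisfies `(g₀(ε)²)⁻¹ = a + b log ε⁻¹`. [cite: Balaban1988Convergent, p.244] -/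
theorem inv_sq_bareD4 {a b ε : ℝ} (h : 0 < a + b * Real.log ε⁻¹) :
    (((Real.sqrt (a + b * Real.log ε⁻¹))⁻¹) ^ 2)⁻¹ = a + b * Real.log ε⁻¹ := by
  rw [inv_pow, inv_inv, Real.sq_sqrt h.le]

/-- For `a + b log ε⁻¹ > 0`, `p0Profile A q (g₀(ε)) = A·(log(a + b log ε⁻¹))^{q}` — the profile `p₀` of p. 244 at the
printed `d = 4` bare coupling. [cite: Balaban1988Convergent, p.244] -/
theorem p0Profile_bareD4 (A : ℝ) (q : ℕ) {a b ε : ℝ} (h : 0 < a + b * Real.log ε⁻¹) :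
    p0Profile A q (Real.sqrt (a + b * Real.log ε⁻¹))⁻¹ = A * Real.log (a + b * Real.log ε⁻¹) ^ q := by
  rw [p0Profile, inv_sq_bareD4 h]

/-- `a + b log ε⁻¹ > 0` eventually as `ε → 0⁺` (`b > 0`), so the model coupling `g₀(ε) = (a + b log ε⁻¹)^{−1/2}` of
p. 244 is eventually a genuine inverse square root («for ε → 0»). [cite: Balaban1988Convergent, p.244] -/
theorem eventually_bareD4_pos (a : ℝ) {b : ℝ} (hb : 0 < b) :
    ∀ᶠ ε : ℝ in 𝓝[>] (0 : ℝ), 0 < a + b * Real.log ε⁻¹ :=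
  ((tendsto_affine_atTop a hb).comp tendsto_log_inv_nhdsGT_zero).eventually_gt_atTop 0

/-- **«it controls a large number of steps»** (p. 244 [PDF 2], `d = 4`): `P(ε) = p0Profile A q (g₀(ε)) → ∞` as
`ε → 0⁺`, for `A > 0`, `q ≥ 1`, `b > 0` — hence so does the number `P(ε)/c` of steps of cost `e^{c}` the factor
`e^{−P(ε)}` pays for (reading note (r5)). [cite: Balaban1988Convergent, p.244] -/
theorem tendsto_p0Profile_bareD4_atTop {A : ℝ} (hA : 0 < A) {q : ℕ} (hq : 1 ≤ q) (a : ℝ) {b : ℝ} (hb : 0 < b) :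
    Tendsto (fun ε : ℝ => p0Profile A q (Real.sqrt (a + b * Real.log ε⁻¹))⁻¹) (𝓝[>] (0 : ℝ)) atTop := by
  have h := (tendsto_logpow_affine_atTop a hb hA hq).comp tendsto_log_inv_nhdsGT_zero
  refine h.congr' ?_
  filter_upwards [eventually_bareD4_pos a hb] with ε hε
  rw [Function.comp_apply, p0Profile_bareD4 A q hε]

/-- **«It is still small for ε small»** (p. 244 [PDF 2], `d = 4`): the factor `e^{−P(ε)}` tends to `0` as `ε → 0⁺`
(`A > 0`, `q ≥ 1`, `b > 0`). [cite: Balaban1988Convergent, p.244] -/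
theorem tendsto_largeFieldFactor_bareD4_zero {A : ℝ} (hA : 0 < A) {q : ℕ} (hq : 1 ≤ q) (a : ℝ) {b : ℝ} (hb : 0 < b) :
    Tendsto (fun ε : ℝ => Real.exp (-(p0Profile A q (Real.sqrt (a + b * Real.log ε⁻¹))⁻¹))) (𝓝[>] (0 : ℝ)) (𝓝 0) :=
  Real.tendsto_exp_neg_atTop_nhds_zero.comp (tendsto_p0Profile_bareD4_atTop hA hq a hb)

/-- `P(ε) = o(log ε⁻¹)` as `ε → 0⁺` (`b > 0`; any `A`, `q`): the exponent of the large-field factor is negligible against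
`log ε⁻¹` = `log L ×` (the total number of steps).  The analytic core of the `d = 4` clause. [cite: Balaban1988Convergent, p.244] -/
theorem isLittleO_p0Profile_bareD4_log (A : ℝ) (q : ℕ) (a : ℝ) {b : ℝ} (hb : 0 < b) :
    (fun ε : ℝ => p0Profile A q (Real.sqrt (a + b * Real.log ε⁻¹))⁻¹) =o[𝓝[>] (0 : ℝ)]
      (fun ε : ℝ => Real.log ε⁻¹) := by
  have h := (isLittleO_logpow_affine_atTop a A hb q).comp_tendsto tendsto_log_inv_nhdsGT_zero
  refine h.congr' ?_ (Eventually.of_forall fun _ => rfl)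
  filter_upwards [eventually_bareD4_pos a hb] with ε hε
  rw [Function.comp_apply, p0Profile_bareD4 A q hε]

/-- **«but this number is a small fraction of the total number of steps»** (p. 244 [PDF 2], `d = 4`): the ratio of the
number `P(ε)/c` of controlled steps (cost `e^{c}` per step, reading note (r5)) to the total number `log ε⁻¹/log L` of
steps (reading note (r4), `steps_eq_log_div_log`) tends to `0` as `ε → 0⁺`; the identity
`(P/c)/(ℓ/log L) = (log L/c)·(P/ℓ)` needs no hypothesis on `c`, `L` (field conventions), the content is
`isLittleO_p0Profile_bareD4_log`. [cite: Balaban1988Convergent, p.244] -/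
theorem tendsto_stepsRatio_bareD4_zero (A : ℝ) (q : ℕ) (a : ℝ) {b : ℝ} (hb : 0 < b) (c L : ℝ) :
    Tendsto (fun ε : ℝ => (p0Profile A q (Real.sqrt (a + b * Real.log ε⁻¹))⁻¹ / c) / (Real.log ε⁻¹ / Real.log L))
      (𝓝[>] (0 : ℝ)) (𝓝 0) := by
  have h := ((isLittleO_p0Profile_bareD4_log A q a hb).tendsto_div_nhds_zero).const_mul (Real.log L / c)
  rw [mul_zero] at h
  refine h.congr' (Eventually.of_forall fun ε => ?_)
  simp only [div_div_eq_mul_div]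
  ring

/-- **«hence the bound does not give any positive power of ε»** (p. 244 [PDF 2], `d = 4`), quantitative form: for every
`N > 0` and every constant `C`, eventually as `ε → 0⁺` one has `C·ε^{N} < e^{−P(ε)}` — the large-field factor is
eventually LARGER than any prescribed positive power of `ε` (`b > 0`; any `A`, `q`, `a`). [cite: Balaban1988Convergent, p.244] -/
theorem eventually_pow_lt_largeFieldFactor_bareD4 (A : ℝ) (q : ℕ) (a : ℝ) {b : ℝ} (hb : 0 < b) {N : ℝ} (hN : 0 < N)
    (C : ℝ) : ∀ᶠ ε : ℝ in 𝓝[>] (0 : ℝ),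
      C * ε ^ N < Real.exp (-(p0Profile A q (Real.sqrt (a + b * Real.log ε⁻¹))⁻¹)) := by
  rcases le_or_gt C 0 with hC | hC
  · filter_upwards [self_mem_nhdsWithin] with ε hε
    have h0 : C * ε ^ N ≤ 0 := mul_nonpos_of_nonpos_of_nonneg hC (Real.rpow_nonneg (le_of_lt hε) N)
    exact h0.trans_lt (Real.exp_pos _)
  · have ht := tendsto_log_inv_nhdsGT_zero.eventually (eventually_logpow_lt_linear a A hb q hN (Real.log C))
    filter_upwards [ht, eventually_bareD4_pos a hb, self_mem_nhdsWithin] with ε h1 h2 h3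
    have hε : 0 < ε := h3
    rw [p0Profile_bareD4 A q h2]
    have key : Real.exp (Real.log C - N * Real.log ε⁻¹) <
        Real.exp (-(A * Real.log (a + b * Real.log ε⁻¹) ^ q)) :=
      Real.exp_lt_exp.mpr (by linarith)
    have harg : Real.log C - N * Real.log ε⁻¹ = Real.log C + Real.log ε * N := by
      rw [Real.log_inv]; ring
    rwa [harg, Real.exp_add, Real.exp_log hC, ← Real.rpow_def_of_pos hε] at key

/-- The `d = 4` clause as a NEGATION (p. 244 [PDF 2]: «does not give any positive power of ε»): for no `N > 0` and no
constant `C` is `e^{−P(ε)} ≤ C·ε^{N}` eventually as `ε → 0⁺`. [cite: Balaban1988Convergent, p.244] -/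
theorem not_eventually_largeFieldFactor_le_pow (A : ℝ) (q : ℕ) (a : ℝ) {b : ℝ} (hb : 0 < b) {N : ℝ} (hN : 0 < N)
    (C : ℝ) : ¬ ∀ᶠ ε : ℝ in 𝓝[>] (0 : ℝ),
      Real.exp (-(p0Profile A q (Real.sqrt (a + b * Real.log ε⁻¹))⁻¹)) ≤ C * ε ^ N := by
  intro h
  obtain ⟨ε, h1, h2⟩ := ((eventually_pow_lt_largeFieldFactor_bareD4 A q a hb hN C).and h).exists
  exact absurd h2 (not_le.mpr h1)

/-- The `d = 4` clause in Landau notation: `ε^{N} = o(e^{−P(ε)})` as `ε → 0⁺`, for every `N > 0` (`b > 0`). [cite: Balaban1988Convergent, p.244] -/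
theorem isLittleO_pow_largeFieldFactor_bareD4 (A : ℝ) (q : ℕ) (a : ℝ) {b : ℝ} (hb : 0 < b) {N : ℝ} (hN : 0 < N) :
    (fun ε : ℝ => ε ^ N) =o[𝓝[>] (0 : ℝ)]
      (fun ε : ℝ => Real.exp (-(p0Profile A q (Real.sqrt (a + b * Real.log ε⁻¹))⁻¹))) := by
  refine isLittleO_iff.mpr (fun c hc => ?_)
  filter_upwards [eventually_pow_lt_largeFieldFactor_bareD4 A q a hb hN c⁻¹, self_mem_nhdsWithin] with ε h hε
  rw [Real.norm_of_nonneg (Real.rpow_nonneg (le_of_lt hε) N), Real.norm_of_nonneg (Real.exp_pos _).le]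
  exact ((inv_mul_lt_iff₀ hc).mp h).le

end Literature.MathematicalPhysics.QuantumFieldTheory.Balaban1983to89.B14.LargeFieldFactorD4

end
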